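import Literature.MathematicalPhysics.QuantumLattice.SectorisedIncrementBoundDBPlateau
import Literature.MathematicalPhysics.QuantumLattice.GrassmannEffectiveActionGradedTruncationPrescribedDB
import Literature.MathematicalPhysics.QuantumLattice.SectorisedKernelNormPrescribedBridge
import HarnessLib

/-!
# The orders `≥ 2` of the sectorised single-scale INCREMENT in GRADED form with PRESCRIBED output legs (the LEVELS track), plateau transport

Topic `MathematicalPhysics/QuantumLattice`; the prescribed-legs twin of `SectorisedIncrementBoundGradedPlateau`.  The abstract supplier is G1-L
(`GrassmannEffectiveActionGradedTruncationPrescribedDB.sum_norm_kernel_effAction_sub_gaussConv_le_graded_prescribed_of_gramBounded`: orders `2 ≤ n < N₀` of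
`effAction C V − e^{Δ_C}V` with one output leg pinned, the output legs `j ∈ J` constrained to predicates `A j`, graded terms AVERAGED over the landing profiles
of the constrained legs, inputs through their anchored norms `N(m′, F)` with `F` further legs constrained).  Reading it through a substitution `f` and an
analysis map `g` needs a Young inequality that TRANSPORTS A PRESCRIPTION: if the output leg `j` is constrained to `P j` and the transform's matrix entry
`M(y′, x)` vanishes unless `P j y′ ⇒ A j x` (for sector analysis: a fine sector only overlaps its coarse parents), then the constrained output sum costs
`cr·cc^m` times the `A`-constrained input sum (Benfatto–Giuliani–Mastropietro 2006 §2.8 (2.82)–(2.84), (2.88)–(2.90), App. A3: known sectors are inherited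
leg by leg through the re-sectorisation).  Then the plateau machinery of the flat files transports everything to the Hubbard torus, with G1-L's input
hypothesis discharged from the COARSE-family prescribed sizes of the input by k3c2-p3's bridge
(`SectorisedKernelNormPrescribedBridge.sum_norm_kernel_sectorPreimage_prescribedSlots_le_of_prescribedSum_le`):

* §0 (generic) **`sum_filter_norm_transform_prescribed_le`** / **`sum_filter_norm_kernel_map_prescribed_le`** — Young's inequality for the multi-leg transform
  with one leg pinned and a set `J` of legs PRESCRIBED: `Σ_{X′_p = w′, P j (X′_j) ∀ j∈J} ‖Σ_X (∏ M(X′_i,X_i)) K(X)‖ ≤ cr·cc^m·N_K`, `N_K` a bound on the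
  `A`-constrained pinned sums `Σ_{X_p = x, A j (X_j) ∀ j∈J} ‖K(X)‖`, under the compatibility `P j y′ ∧ M(y′,x) ≠ 0 ⇒ A j x`;
* §1 (generic label sets) **`sum_filter_norm_kernel_map_effAction_sub_gaussConv_le_graded_prescribed_of_gramBounded`** — G1-L read through `(f, g)`;
* §2 (Hubbard torus) **`sum_filter_norm_sectorAnalysis_effAction_sub_gaussConv_le_graded_prescribed_of_plateau`** — thin/fat input families `F, F̃`, output
  family `F′` in the plateau of `F`, a relation `child` between fine and coarse sector indices outside which the overlap matrix `E(F′)S(F̃)` vanishes, even `G`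
  without constant part, sectorised covariance replica-Gram-bounded with row/column sums `≤ α`, COARSE-family prescribed sizes
  `ε_x^{2m′−1} Σ_{σ′|_E = τ′|_E} Σ_{x′_q = y} ‖W_{F,σ′}(x′)‖ ≤ B m′ (|E|−1)` of `G`, overlap costs `(cr, cc)`; then for the increment, one output leg pinned at
  `w″`, fine labels `τ″_j` prescribed on `j ∈ J`:
  `Σ_{X″_p = w″, (X″_j).2 = τ″_j ∀ j∈J} ‖kernel (map (toLin' E(F′)) (effAction C G − e^{Δ_C}G)) (m+1) X″‖ ≤ cr·cc^m·[graded-prescribed + tail](N(m′,F) := ε_x·B m′ F)`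
  where the graded term's constrained legs land on the coarse PARENTS of the prescribed fine labels (predicates `child (τ″_j) ·`).

Everything is proved; no definition, no named fact.  NOT here: the first order (prescribed binomial–Gram, `GrassmannGaussConvBinomialGramPrescribed` + §0 + the
same transport), the weighted-prescribed twin, and every model constant/count (the parents-per-fine-sector count and the levels law are the consumer's).

## Sources

G. Benfatto, A. Giuliani, V. Mastropietro, Ann. Henri Poincaré 7 (2006) 809–898, (2.61)–(2.63), (2.66), (2.70)–(2.71a), §2.8 (2.76)–(2.84), (2.88)–(2.90),
App. A3 Lemma A3.1 [`BenfattoGiulianiMastropietro2006`]; W. de Siqueira Pedra, M. Salmhofer, Comm. Math. Phys. 282 (2008) 797–818, Thm 1.3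
[`PedraSalmhofer2008`]; K. Gawȩdzki, A. Kupiainen, Comm. Math. Phys. 102 (1985) 1–30, §3 [`GawedzkiKupiainen1985GrossNeveu`].
-/

noncomputable section

namespace Literature.MathematicalPhysics.QuantumLattice

open GrassmannAlgebra Finset Literature.Probability.LatticeModels
open scoped Nat

universe u

/-! ### §0 Young's inequality for the multi-leg transform with PRESCRIBED legs -/

section Young

variable {𝕜 : Type*} [RCLike 𝕜] {Γ Γ' : Type*} [Fintype Γ] [DecidableEq Γ] [Fintype Γ'] [DecidableEq Γ']

/-- **Young's inequality for the multi-leg transform, one leg pinned and a set of legs PRESCRIBED** (BGM 2006 (2.71a) with §2.8 (2.88)–(2.90): known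
sectors are inherited leg by leg).  `Mf` has row sums `≤ cr` and column sums `≤ cc`; the output legs `j ∈ J` are constrained to `P j`, and
`P j y′ ∧ Mf y′ x ≠ 0 ⇒ A j x` (a fine label only overlaps its coarse parents); the `A`-constrained pinned sums of `K` are `≤ N_K`.  Then
`Σ_{X′ : X′_p = w′, P j (X′_j) ∀ j ∈ J} ‖Σ_X (∏ᵢ Mf X′ᵢ Xᵢ) K X‖ ≤ cr · cc^m · N_K`. [cite: BenfattoGiulianiMastropietro2006, (2.71a), (2.88)-(2.90)] -/
theorem sum_filter_norm_transform_prescribed_le {m : ℕ} (K : (Fin (m + 1) → Γ) → 𝕜) (Mf : Γ' → Γ → 𝕜) {cr cc : ℝ}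
    (hcc0 : 0 ≤ cc) (hrow : ∀ y', ∑ x, ‖Mf y' x‖ ≤ cr) (hcol : ∀ x, ∑ y', ‖Mf y' x‖ ≤ cc)
    (p : Fin (m + 1)) (J : Finset (Fin (m + 1))) (P : Fin (m + 1) → Γ' → Prop) [∀ j, DecidablePred (P j)]
    (A : Fin (m + 1) → Γ → Bool) (hPA : ∀ j ∈ J, ∀ (y' : Γ') (x : Γ), P j y' → Mf y' x ≠ 0 → A j x = true)
    {NK : ℝ} (hNK0 : 0 ≤ NK)
    (hK : ∀ x, ∑ X ∈ univ.filter (fun X : Fin (m + 1) → Γ => X p = x ∧ ∀ j ∈ J, A j (X j) = true), ‖K X‖ ≤ NK) (w' : Γ') :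
    ∑ X' ∈ univ.filter (fun X' : Fin (m + 1) → Γ' => X' p = w' ∧ ∀ j ∈ J, P j (X' j)),
        ‖∑ X : Fin (m + 1) → Γ, (∏ i, Mf (X' i) (X i)) * K X‖ ≤ cr * cc ^ m * NK := by
  classical
  set S : Finset (Fin (m + 1) → Γ') := univ.filter (fun X' : Fin (m + 1) → Γ' => X' p = w' ∧ ∀ j ∈ J, P j (X' j)) with hS
  set ind : (Fin (m + 1) → Γ) → ℝ := fun X => if (∀ j ∈ J, A j (X j) = true) then 1 else 0 with hind
  have hind0 : ∀ X, 0 ≤ ind X := fun X => by rw [hind]; dsimp only; split_ifs <;> norm_num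
  have hind1 : ∀ X, ind X ≤ 1 := fun X => by rw [hind]; dsimp only; split_ifs <;> norm_num
  -- (1) triangle inequality and exchange of the sums
  have h1 : ∑ X' ∈ S, ‖∑ X : Fin (m + 1) → Γ, (∏ i, Mf (X' i) (X i)) * K X‖ ≤
      ∑ X : Fin (m + 1) → Γ, ‖K X‖ * ∑ X' ∈ S, ∏ i, ‖Mf (X' i) (X i)‖ := by
    calc ∑ X' ∈ S, ‖∑ X : Fin (m + 1) → Γ, (∏ i, Mf (X' i) (X i)) * K X‖
        ≤ ∑ X' ∈ S, ∑ X : Fin (m + 1) → Γ, (∏ i, ‖Mf (X' i) (X i)‖) * ‖K X‖ :=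
          sum_le_sum fun X' _ => (norm_sum_le _ _).trans (le_of_eq (sum_congr rfl fun X _ => by rw [norm_mul, norm_prod]))
      _ = ∑ X : Fin (m + 1) → Γ, ‖K X‖ * ∑ X' ∈ S, ∏ i, ‖Mf (X' i) (X i)‖ := by
          rw [sum_comm]
          refine sum_congr rfl fun X _ => ?_
          rw [mul_sum]
          exact sum_congr rfl fun X' _ => mul_comm _ _
  -- (1b) the prescription is inherited by the input legs
  have h1b : ∀ X : Fin (m + 1) → Γ, ∑ X' ∈ S, ∏ i, ‖Mf (X' i) (X i)‖ ≤
      ind X * (‖Mf w' (X p)‖ * ∏ i ∈ univ.erase p, ∑ y', ‖Mf y' (X i)‖) := by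
    intro X
    by_cases hA : ∀ j ∈ J, A j (X j) = true
    · rw [hind]; dsimp only; rw [if_pos hA, one_mul, ← sum_filter_prod_norm_eq]
      refine sum_le_sum_of_subset_of_nonneg (fun X' hX' => ?_) fun X' _ _ => prod_nonneg fun i _ => norm_nonneg _
      rw [hS, mem_filter] at hX'
      exact mem_filter.2 ⟨mem_univ _, hX'.2.1⟩
    · push Not at hA
      obtain ⟨j, hjJ, hj⟩ := hA
      rw [hind]; dsimp only; rw [if_neg (fun h => hj (h j hjJ)), zero_mul]
      refine (sum_eq_zero fun X' hX' => ?_).le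
      rw [hS, mem_filter] at hX'
      have hzero : Mf (X' j) (X j) = 0 := by
        by_contra hne
        exact hj (hPA j hjJ (X' j) (X j) (hX'.2.2 j hjJ) hne)
      exact prod_eq_zero (mem_univ j) (by rw [hzero, norm_zero])
  -- (2) the summed legs cost `cc^m`
  have h2 : ∀ X : Fin (m + 1) → Γ, ‖K X‖ * (ind X * (‖Mf w' (X p)‖ * ∏ i ∈ univ.erase p, ∑ y', ‖Mf y' (X i)‖)) ≤
      ind X * ‖K X‖ * ‖Mf w' (X p)‖ * cc ^ m := by
    intro X
    have hpe := prod_erase_le_pow p _ (fun i => sum_nonneg fun _ _ => norm_nonneg (Mf _ (X i))) fun i => hcol (X i)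
    have := mul_le_mul_of_nonneg_left hpe (mul_nonneg (mul_nonneg (hind0 X) (norm_nonneg (K X))) (norm_nonneg (Mf w' (X p))))
    calc ‖K X‖ * (ind X * (‖Mf w' (X p)‖ * ∏ i ∈ univ.erase p, ∑ y', ‖Mf y' (X i)‖))
        = ind X * ‖K X‖ * ‖Mf w' (X p)‖ * ∏ i ∈ univ.erase p, ∑ y', ‖Mf y' (X i)‖ := by ring
      _ ≤ ind X * ‖K X‖ * ‖Mf w' (X p)‖ * cc ^ m := this
  -- (3) the pinned leg: fibre over `X p`, with the `A`-constraint inside the fibre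
  have h3 : ∑ X : Fin (m + 1) → Γ, ind X * ‖K X‖ * ‖Mf w' (X p)‖ * cc ^ m =
      cc ^ m * ∑ x, ‖Mf w' x‖ * ∑ X ∈ univ.filter (fun X : Fin (m + 1) → Γ => X p = x), ind X * ‖K X‖ := by
    rw [mul_sum, ← sum_fiberwise univ (fun X : Fin (m + 1) → Γ => X p)]
    refine sum_congr rfl fun x _ => ?_
    rw [mul_sum, mul_sum]
    refine sum_congr rfl fun X hX => ?_
    rw [(mem_filter.1 hX).2]
    ring
  have h4 : ∀ x, ∑ X ∈ univ.filter (fun X : Fin (m + 1) → Γ => X p = x), ind X * ‖K X‖ ≤ NK := by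
    intro x
    have heq : ∑ X ∈ univ.filter (fun X : Fin (m + 1) → Γ => X p = x ∧ ∀ j ∈ J, A j (X j) = true), ‖K X‖ =
        ∑ X ∈ univ.filter (fun X : Fin (m + 1) → Γ => X p = x), ind X * ‖K X‖ := by
      rw [← filter_filter, sum_filter]
      refine sum_congr rfl fun X _ => ?_
      rw [hind]; dsimp only
      split_ifs <;> simp
    rw [← heq]
    exact hK x
  calc ∑ X' ∈ S, ‖∑ X : Fin (m + 1) → Γ, (∏ i, Mf (X' i) (X i)) * K X‖
      ≤ ∑ X : Fin (m + 1) → Γ, ind X * ‖K X‖ * ‖Mf w' (X p)‖ * cc ^ m :=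
        h1.trans (sum_le_sum fun X _ => (mul_le_mul_of_nonneg_left (h1b X) (norm_nonneg _)).trans (h2 X))
    _ = cc ^ m * ∑ x, ‖Mf w' x‖ * ∑ X ∈ univ.filter (fun X : Fin (m + 1) → Γ => X p = x), ind X * ‖K X‖ := h3
    _ ≤ cc ^ m * ∑ x, ‖Mf w' x‖ * NK :=
        mul_le_mul_of_nonneg_left (sum_le_sum fun x _ => mul_le_mul_of_nonneg_left (h4 x) (norm_nonneg _)) (pow_nonneg hcc0 _)
    _ = cc ^ m * ((∑ x, ‖Mf w' x‖) * NK) := by rw [sum_mul]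
    _ ≤ cc ^ m * (cr * NK) := mul_le_mul_of_nonneg_left (mul_le_mul_of_nonneg_right (hrow w') hNK0) (pow_nonneg hcc0 _)
    _ = cr * cc ^ m * NK := by ring

variable [Algebra ℚ 𝕜]

/-- **Substituting the legs with PRESCRIBED output legs**: for a linear substitution `f` with matrix `M = toMatrix' f` (row sums `≤ cr`, column sums `≤ cc`),
output legs `j ∈ J` constrained to `P j`, input predicates `A j` with `P j y′ ∧ M y′ x ≠ 0 ⇒ A j x`, and `A`-constrained pinned sums of `kernel F (m+1)` bounded by `N_K`:
`Σ_{X′ : X′_p = w′, P j (X′_j) ∀ j ∈ J} ‖kernel (map f F) (m+1) X′‖ ≤ cr · cc^m · N_K`. [cite: BenfattoGiulianiMastropietro2006, (2.71a), (2.88)-(2.90)] -/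
theorem sum_filter_norm_kernel_map_prescribed_le (f : (Γ → 𝕜) →ₗ[𝕜] (Γ' → 𝕜)) {cr cc : ℝ} (hcc0 : 0 ≤ cc)
    (hrow : ∀ y', ∑ x, ‖LinearMap.toMatrix' f y' x‖ ≤ cr) (hcol : ∀ x, ∑ y', ‖LinearMap.toMatrix' f y' x‖ ≤ cc)
    (F : GrassmannAlgebra 𝕜 Γ) (m : ℕ) (p : Fin (m + 1)) (J : Finset (Fin (m + 1))) (P : Fin (m + 1) → Γ' → Prop) [∀ j, DecidablePred (P j)]
    (A : Fin (m + 1) → Γ → Bool) (hPA : ∀ j ∈ J, ∀ (y' : Γ') (x : Γ), P j y' → LinearMap.toMatrix' f y' x ≠ 0 → A j x = true)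
    {NK : ℝ} (hNK0 : 0 ≤ NK)
    (hK : ∀ x, ∑ X ∈ univ.filter (fun X : Fin (m + 1) → Γ => X p = x ∧ ∀ j ∈ J, A j (X j) = true), ‖kernel 𝕜 F (m + 1) X‖ ≤ NK) (w' : Γ') :
    ∑ X' ∈ univ.filter (fun X' : Fin (m + 1) → Γ' => X' p = w' ∧ ∀ j ∈ J, P j (X' j)), ‖kernel 𝕜 (ExteriorAlgebra.map f F) (m + 1) X'‖ ≤
      cr * cc ^ m * NK := by
  simp only [kernel_map]
  exact sum_filter_norm_transform_prescribed_le _ _ hcc0 hrow hcol p J P A hPA hNK0 hK w'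

end Young

/-! ### §1 Generic label sets: G1-L read through `(f, g)` -/

section Generic

variable {𝕜 : Type*} [RCLike 𝕜] {Γ Γ' Γ'' : Type u} [Fintype Γ] [DecidableEq Γ] [Fintype Γ'] [DecidableEq Γ']
  [Fintype Γ''] [DecidableEq Γ'']

/-- Nonnegativity of the graded-prescribed right side (private helper). [folklore] -/
private theorem gradedPrescribedRHS_nonneg (Γ' : Type u) [Fintype Γ'] {κ α ρ : ℝ} (hκ : 0 < κ) (hα : 0 ≤ α) (hρ : 0 ≤ ρ) {m : ℕ}
    (J : Finset (Fin (m + 1))) (N : ℕ → ℕ → ℝ) (hN0 : ∀ m' F, 0 ≤ N m' F)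
    (hθ : Real.exp 1 * α * normV Γ' κ ρ (fun m' => N m' 0) / κ ^ 2 < 1) (N₀ : ℕ) :
    0 ≤ ∑ n ∈ Ico 2 N₀, (κ⁻¹ ^ (m + 1) * κ⁻¹ ^ (2 * (n - 1)) * (α ^ (n - 1) * Real.exp n)) *
          ∑ δ ∈ (Fintype.piFinset fun _ : Fin n => range (Fintype.card Γ' / 2 + 1)) with m + 1 + 2 * (n - 1) ≤ ∑ a, 2 * δ a,
            ∑ pf : J → Fin n, ((∏ j, ((2 * δ (pf j) : ℕ) : ℝ)) / ((∑ a, 2 * δ a : ℕ) : ℝ) ^ J.card) *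
              ∏ a, (Real.exp 3 * κ) ^ (2 * δ a) * N (δ a) (univ.filter fun j : J => pf j = a).card +
        ρ⁻¹ ^ (m + 1) * (Real.exp 1 * normV Γ' κ ρ (fun m' => N m' 0)) *
          (Real.exp 1 * α * normV Γ' κ ρ (fun m' => N m' 0) / κ ^ 2) ^ (N₀ - 1) /
            (1 - Real.exp 1 * α * normV Γ' κ ρ (fun m' => N m' 0) / κ ^ 2) := by
  have hV0 : 0 ≤ normV Γ' κ ρ (fun m' => N m' 0) := normV_nonneg hκ.le hρ fun m' => hN0 m' 0
  refine add_nonneg (sum_nonneg fun n _ => mul_nonneg (by positivity) (sum_nonneg fun δ _ => sum_nonneg fun pf _ =>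
    mul_nonneg (by positivity) (prod_nonneg fun a _ => mul_nonneg (by positivity) (hN0 _ _)))) ?_
  exact div_nonneg (by positivity) (by linarith)

/-- **The graded orders `≥ 2` with PRESCRIBED output legs, read through `(f, g)`** (BGM 2006 (2.61)–(2.63), (2.66), (2.77)–(2.84), (2.88)–(2.90)): `Ṽ` even without
constant part on the auxiliary labels `Γ′`; `C′ = fᵀ C f` replica-Gram-bounded (`κ > 0`) with row/column sums `≤ α`; the output legs `j ∈ J` of degree `m+1`
constrained to `P j` (labels of `Γ″`), predicates `A j` on `Γ′` inherited through the matrix of `g ∘ f` (`P j y″ ∧ (g∘f)(y″,x′) ≠ 0 ⇒ A j x′`); the input `Ṽ`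
through its `A`-constrained anchored norms `N(m′, F)` (G1-L's `hN`); `θ < 1`; analysis costs `(cr, cc)`; `N₀ ≥ 2`, `p ∉ J`.  Then
`Σ_{X″_p = w″, P j (X″_j) ∀ j∈J} ‖kernel_{m+1}(map g (effAction C (map f Ṽ) − e^{Δ_C}(map f Ṽ)))(X″)‖ ≤ cr·cc^m·[graded-prescribed + tail](N)`.
[cite: BenfattoGiulianiMastropietro2006, (2.61)-(2.63), (2.66), (2.84), (2.88)-(2.90)] -/
theorem sum_filter_norm_kernel_map_effAction_sub_gaussConv_le_graded_prescribed_of_gramBounded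
    (C : Matrix Γ Γ 𝕜) (f : (Γ' → 𝕜) →ₗ[𝕜] (Γ → 𝕜)) (g : (Γ → 𝕜) →ₗ[𝕜] (Γ'' → 𝕜))
    (Vt : GrassmannAlgebra 𝕜 Γ') (hVt : Vt ∈ evenPart 𝕜 Γ') (hVt0 : constPart 𝕜 Vt = 0)
    {κ : ℝ} (hκ : 0 < κ) (hGB : IsGramBoundedR ((LinearMap.toMatrix' f).transpose * C * LinearMap.toMatrix' f) κ)
    {m : ℕ} (p : Fin (m + 1)) (J : Finset (Fin (m + 1))) (hp : p ∉ J) (P : Fin (m + 1) → Γ'' → Prop) [∀ j, DecidablePred (P j)]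
    (A : Fin (m + 1) → Γ' → Bool)
    (hPA : ∀ j ∈ J, ∀ (y'' : Γ'') (x' : Γ'), P j y'' → (LinearMap.toMatrix' g * LinearMap.toMatrix' f) y'' x' ≠ 0 → A j x' = true)
    (N : ℕ → ℕ → ℝ) (hN0 : ∀ m' F, 0 ≤ N m' F)
    (hN : ∀ (m' : ℕ) (T : Finset (Fin (m + 1))), T ⊆ J → ∀ (ι : T → Fin (2 * m')), Function.Injective ι →
      ∀ (t : Fin (2 * m')), (∀ j, ι j ≠ t) → ∀ a : Γ',
        ∑ Y ∈ univ.filter (fun Y : Fin (2 * m') → Γ' => Y t = a),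
          ‖kernel 𝕜 Vt (2 * m') Y‖ * ∏ j : T, (if A j (Y (ι j)) = true then (1 : ℝ) else 0) ≤ N m' T.card)
    {α : ℝ} (hα : 0 < α)
    (hrow : ∀ X, ∑ Y, ‖((LinearMap.toMatrix' f).transpose * C * LinearMap.toMatrix' f) X Y‖ ≤ α)
    (hcol : ∀ Y, ∑ X, ‖((LinearMap.toMatrix' f).transpose * C * LinearMap.toMatrix' f) X Y‖ ≤ α)
    {ρ : ℝ} (hρ : 0 < ρ) (hθ : Real.exp 1 * α * normV Γ' κ ρ (fun m' => N m' 0) / κ ^ 2 < 1)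
    {cr cc : ℝ} (hcc0 : 0 ≤ cc)
    (hrow' : ∀ X'', ∑ X', ‖(LinearMap.toMatrix' g * LinearMap.toMatrix' f) X'' X'‖ ≤ cr)
    (hcol' : ∀ X', ∑ X'', ‖(LinearMap.toMatrix' g * LinearMap.toMatrix' f) X'' X'‖ ≤ cc)
    {N₀ : ℕ} (hN₀ : 2 ≤ N₀) (w'' : Γ'') :
    ∑ X'' ∈ univ.filter (fun X'' : Fin (m + 1) → Γ'' => X'' p = w'' ∧ ∀ j ∈ J, P j (X'' j)),
        ‖kernel 𝕜 (ExteriorAlgebra.map g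
          (effAction 𝕜 C (ExteriorAlgebra.map f Vt) - gaussConv 𝕜 C (ExteriorAlgebra.map f Vt))) (m + 1) X''‖ ≤
      cr * cc ^ m *
        (∑ n ∈ Ico 2 N₀, (κ⁻¹ ^ (m + 1) * κ⁻¹ ^ (2 * (n - 1)) * (α ^ (n - 1) * Real.exp n)) *
            ∑ δ ∈ (Fintype.piFinset fun _ : Fin n => range (Fintype.card Γ' / 2 + 1)) with m + 1 + 2 * (n - 1) ≤ ∑ a, 2 * δ a,
              ∑ pf : J → Fin n, ((∏ j, ((2 * δ (pf j) : ℕ) : ℝ)) / ((∑ a, 2 * δ a : ℕ) : ℝ) ^ J.card) *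
                ∏ a, (Real.exp 3 * κ) ^ (2 * δ a) * N (δ a) (univ.filter fun j : J => pf j = a).card +
          ρ⁻¹ ^ (m + 1) * (Real.exp 1 * normV Γ' κ ρ (fun m' => N m' 0)) *
            (Real.exp 1 * α * normV Γ' κ ρ (fun m' => N m' 0) / κ ^ 2) ^ (N₀ - 1) /
              (1 - Real.exp 1 * α * normV Γ' κ ρ (fun m' => N m' 0) / κ ^ 2)) := by
  set C' : Matrix Γ' Γ' 𝕜 := (LinearMap.toMatrix' f).transpose * C * LinearMap.toMatrix' f with hC'
  -- G1-L in the auxiliary representation, for every pin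
  have hK : ∀ a : Γ', ∑ W ∈ univ.filter (fun W : Fin (m + 1) → Γ' => W p = a ∧ ∀ j ∈ J, A j (W j) = true),
      ‖kernel 𝕜 (effAction 𝕜 C' Vt - gaussConv 𝕜 C' Vt) (m + 1) W‖ ≤ _ :=
    fun a => sum_norm_kernel_effAction_sub_gaussConv_le_graded_prescribed_of_gramBounded C' hκ hGB Vt hVt hVt0 J A N hN0 hN hα hrow hcol
      hρ hθ hN₀ (Nat.succ_pos m) p hp a
  have hB0 := gradedPrescribedRHS_nonneg Γ' hκ hα.le hρ.le J N hN0 hθ N₀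
  -- read through `g ∘ f`
  have hsub : effAction 𝕜 C (ExteriorAlgebra.map f Vt) - gaussConv 𝕜 C (ExteriorAlgebra.map f Vt) =
      ExteriorAlgebra.map f (effAction 𝕜 C' Vt - gaussConv 𝕜 C' Vt) := by
    rw [effAction_map, gaussConv_map, map_sub]
  rw [hsub, map_map_eq_map_comp]
  exact sum_filter_norm_kernel_map_prescribed_le (g ∘ₗ f) hcc0
    (by intro X''; rw [LinearMap.toMatrix'_comp]; exact hrow' X'')
    (by intro X'; simp only [LinearMap.toMatrix'_comp]; exact hcol' X') (effAction 𝕜 C' Vt - gaussConv 𝕜 C' Vt) m p J P A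
    (by intro j hj y'' x' hPj hne; rw [LinearMap.toMatrix'_comp] at hne; exact hPA j hj y'' x' hPj hne) hB0 hK w''

end Generic

/-! ### §2 The Hubbard torus: plateau transfer, G1-L's input discharged from the coarse-family prescribed sizes -/

section Transfer

variable {L M : ℕ} [NeZero L] [NeZero M] {N N' : ℕ}

omit [NeZero L] [NeZero M] in
/-- Expanding a product of set-membership indicators over the choices: `∏_{j} [v j ∈ P j] = Σ_{s ∈ Π_j P j} ∏_j [v j = s j]`. [folklore] -/
private theorem prod_ite_mem_eq_sum_prod_ite_eq {ι₀ S : Type*} [Fintype ι₀] [DecidableEq ι₀] [DecidableEq S] (Par : ι₀ → Finset S) (v : ι₀ → S) :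
    (∏ j, (if v j ∈ Par j then (1 : ℝ) else 0)) = ∑ s ∈ Fintype.piFinset Par, ∏ j, (if v j = s j then (1 : ℝ) else 0) := by
  have h : ∀ j, (if v j ∈ Par j then (1 : ℝ) else 0) = ∑ y ∈ Par j, (if v j = y then (1 : ℝ) else 0) := fun j => by
    rw [Finset.sum_ite_eq]
  simp_rw [h]
  exact Finset.prod_univ_sum (fun j => Par j) (fun j y => if v j = y then (1 : ℝ) else 0)

/-- **The orders `≥ 2` of the increment of the sectorised kernels across one slice, GRADED, with PRESCRIBED output legs — the LEVELS track**
(BGM 2006 (2.61)–(2.63), (2.66), §2.8 (2.82)–(2.84), (2.88)–(2.90), App. A3 Lemma A3.1).  Data: thin/fat input families `F, F̃` (`F̃F = F`, `ΣF = 0 ⇒ F = 0`),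
output family `F′` in the plateau of `F` over `supp C` and over `F′`; a relation `child` on sector indices such that the overlap matrix `E(F′)S(F̃)` vanishes
unless the coarse label is a PARENT of the fine one (child on the sector index, same spin and charge), at most `ρc` parents per fine label; an even input `G`
without constant part whose COARSE-family prescribed sizes are bounded: for every degree `2m′ ≥ 2`, every leg set `E ∋ q` with `|E| = F + 1` and every
prescription `τ`, `ε_x^{2m′−1} Σ_{σ′|_E = τ|_E} Σ_{x′_q = y} ‖W_{F,σ′}(x′)‖ ≤ B m′ F`; the sectorised covariance `S(F̃)ᵀ C S(F̃)` replica-Gram-bounded (`κ > 0`)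
with row/column sums `≤ α`; `θ < 1` for the profile `m′ ↦ ρc⁰·(ε_x·B m′ 0)`; overlap costs `(cr, cc)`; `N₀ ≥ 2`; output degree `m + 1`, leg `p` pinned at `w″`,
legs `j ∈ J` (`p ∉ J`) prescribed to the fine labels `τ″ j`.  Then
`Σ_{X″_p = w″, (X″_j).2 = τ″_j ∀ j∈J} ‖kernel (map (toLin' E(F′)) (effAction C G − e^{Δ_C}G)) (m+1) X″‖ ≤ cr·cc^m·[graded-prescribed + tail](N)` with
`N(m′, F) := ρc^F·(ε_x·B m′ F)` — the constrained legs of the graded terms land on the PARENTS of the prescribed fine labels.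
[cite: BenfattoGiulianiMastropietro2006, (2.61)-(2.63), (2.66), (2.84), (2.88)-(2.90), App. A3 Lemma A3.1] -/
theorem sum_filter_norm_sectorAnalysis_effAction_sub_gaussConv_le_graded_prescribed_of_plateau
    {β : ℝ} (hβ : 0 < β) (F Ft : Fin N → FreqMomentum L M → ℂ) (hFF : ∀ ω k, Ft ω k * F ω k = F ω k)
    (hF0 : ∀ k, ∑ ω, F ω k = 0 → ∀ ω, F ω k = 0)
    (F' : Fin N' → FreqMomentum L M → ℂ) (G : HubbardGrassmann L M) (hG : G ∈ evenPart ℂ (HubbardFieldIdx L M))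
    (hG0 : constPart ℂ G = 0)
    (C : Matrix (HubbardFieldIdx L M) (HubbardFieldIdx L M) ℂ)
    (hCpl : ∀ X Y, C X Y ≠ 0 → ∑ ω, F ω X.1.1 = 1 ∧ ∑ ω, F ω Y.1.1 = 1)
    (hF'pl : ∀ (ω' : Fin N') (k : FreqMomentum L M), F' ω' k ≠ 0 → ∑ ω, F ω k = 1)
    (child : Fin N' → Fin N → Prop) [DecidableRel child]
    (hvan : ∀ (X'' : SpaceTimeIdx L M × SectorLeg N') (X' : SpaceTimeIdx L M × SectorLeg N),
      (sectorAnalysisMatrix L M β F' * sectorSubMatrix L M β Ft) X'' X' ≠ 0 →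
        child X''.2.1.1 X'.2.1.1 ∧ X'.2.1.2 = X''.2.1.2 ∧ X'.2.2 = X''.2.2)
    {ρc : ℝ} (hρc0 : 0 ≤ ρc)
    (hρc : ∀ ℓ'' : SectorLeg N',
      (((univ.filter fun ℓ' : SectorLeg N => child ℓ''.1.1 ℓ'.1.1 ∧ ℓ'.1.2 = ℓ''.1.2 ∧ ℓ'.2 = ℓ''.2).card : ℝ)) ≤ ρc)
    {κ : ℝ} (hκ : 0 < κ)
    (hGB : IsGramBoundedR ((sectorSubMatrix L M β Ft).transpose * C * sectorSubMatrix L M β Ft) κ)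
    (B : ℕ → ℕ → ℝ) (hB0 : ∀ m' Fc, 0 ≤ B m' Fc)
    (hB : ∀ (m' Fc : ℕ) (E : Finset (Fin (2 * m' + 1 + 1))) (τ : Fin (2 * m' + 1 + 1) → SectorLeg N) (q : Fin (2 * m' + 1 + 1)),
      q ∈ E → E.card = Fc + 1 → ∀ y : SpaceTimeIdx L M,
        imagTimeWeight β M ^ (2 * m' + 1) *
          ∑ σ ∈ univ.filter (fun σ : Fin (2 * m' + 1 + 1) → SectorLeg N => ∀ e ∈ E, σ e = τ e),
            ∑ x ∈ univ.filter (fun x : Fin (2 * m' + 1 + 1) → SpaceTimeIdx L M => x q = y),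
              ‖sectorisedKernel L M β F G (2 * m' + 1 + 1) σ x‖ ≤ B (m' + 1) Fc)
    {α : ℝ} (hα : 0 < α)
    (hrow : ∀ X, ∑ Y, ‖((sectorSubMatrix L M β Ft).transpose * C * sectorSubMatrix L M β Ft) X Y‖ ≤ α)
    (hcol : ∀ Y, ∑ X, ‖((sectorSubMatrix L M β Ft).transpose * C * sectorSubMatrix L M β Ft) X Y‖ ≤ α)
    {ρ : ℝ} (hρ : 0 < ρ)
    (hθ : Real.exp 1 * α * normV (SpaceTimeIdx L M × SectorLeg N) κ ρ
      (fun m' => ρc ^ 0 * (imagTimeWeight β M * B m' 0)) / κ ^ 2 < 1)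
    {cr cc : ℝ} (hcc0 : 0 ≤ cc)
    (hrow' : ∀ X'', ∑ X', ‖(sectorAnalysisMatrix L M β F' * sectorSubMatrix L M β Ft) X'' X'‖ ≤ cr)
    (hcol' : ∀ X', ∑ X'', ‖(sectorAnalysisMatrix L M β F' * sectorSubMatrix L M β Ft) X'' X'‖ ≤ cc)
    {N₀ : ℕ} (hN₀ : 2 ≤ N₀) {m : ℕ} (p : Fin (m + 1)) (J : Finset (Fin (m + 1))) (hp : p ∉ J) (τ'' : Fin (m + 1) → SectorLeg N')
    (w'' : SpaceTimeIdx L M × SectorLeg N') :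
    ∑ X'' ∈ univ.filter (fun X'' : Fin (m + 1) → SpaceTimeIdx L M × SectorLeg N' => X'' p = w'' ∧ ∀ j ∈ J, (X'' j).2 = τ'' j),
        ‖kernel ℂ (ExteriorAlgebra.map (Matrix.toLin' (sectorAnalysisMatrix L M β F')) (effAction ℂ C G - gaussConv ℂ C G)) (m + 1) X''‖ ≤
      cr * cc ^ m *
        (∑ n ∈ Ico 2 N₀, (κ⁻¹ ^ (m + 1) * κ⁻¹ ^ (2 * (n - 1)) * (α ^ (n - 1) * Real.exp n)) *
            ∑ δ ∈ (Fintype.piFinset fun _ : Fin n => range (Fintype.card (SpaceTimeIdx L M × SectorLeg N) / 2 + 1)) with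
                m + 1 + 2 * (n - 1) ≤ ∑ a, 2 * δ a,
              ∑ pf : J → Fin n, ((∏ j, ((2 * δ (pf j) : ℕ) : ℝ)) / ((∑ a, 2 * δ a : ℕ) : ℝ) ^ J.card) *
                ∏ a, (Real.exp 3 * κ) ^ (2 * δ a) *
                  (ρc ^ (univ.filter fun j : J => pf j = a).card * (imagTimeWeight β M * B (δ a) (univ.filter fun j : J => pf j = a).card)) +
          ρ⁻¹ ^ (m + 1) * (Real.exp 1 * normV (SpaceTimeIdx L M × SectorLeg N) κ ρ (fun m' => ρc ^ 0 * (imagTimeWeight β M * B m' 0))) *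
            (Real.exp 1 * α * normV (SpaceTimeIdx L M × SectorLeg N) κ ρ (fun m' => ρc ^ 0 * (imagTimeWeight β M * B m' 0)) / κ ^ 2) ^
              (N₀ - 1) /
            (1 - Real.exp 1 * α * normV (SpaceTimeIdx L M × SectorLeg N) κ ρ (fun m' => ρc ^ 0 * (imagTimeWeight β M * B m' 0)) / κ ^ 2)) := by
  classical
  have hε : 0 ≤ imagTimeWeight β M := imagTimeWeight_nonneg hβ.le M
  -- the parents of a fine label and the inherited predicates
  set Par : SectorLeg N' → Finset (SectorLeg N) :=
    fun ℓ'' => univ.filter fun ℓ' : SectorLeg N => child ℓ''.1.1 ℓ'.1.1 ∧ ℓ'.1.2 = ℓ''.1.2 ∧ ℓ'.2 = ℓ''.2 with hPar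
  set A : Fin (m + 1) → SpaceTimeIdx L M × SectorLeg N → Bool := fun j X' => decide (X'.2 ∈ Par (τ'' j)) with hA
  set Np : ℕ → ℕ → ℝ := fun m' Fc => ρc ^ Fc * (imagTimeWeight β M * B m' Fc) with hNp
  have hNp0 : ∀ m' Fc, 0 ≤ Np m' Fc := fun m' Fc => mul_nonneg (pow_nonneg hρc0 _) (mul_nonneg hε (hB0 _ _))
  -- G1-L's input hypothesis for the preimage `Ṽ = sectorPreimage β F G`, discharged from `hB` (bridge + parent-set expansion)
  have hN : ∀ (m' : ℕ) (T : Finset (Fin (m + 1))), T ⊆ J → ∀ (ι : T → Fin (2 * m')), Function.Injective ι →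
      ∀ (t : Fin (2 * m')), (∀ j, ι j ≠ t) → ∀ a : SpaceTimeIdx L M × SectorLeg N,
        ∑ Y ∈ univ.filter (fun Y : Fin (2 * m') → SpaceTimeIdx L M × SectorLeg N => Y t = a),
          ‖kernel ℂ (sectorPreimage β F G) (2 * m') Y‖ * ∏ j : T, (if A j (Y (ι j)) = true then (1 : ℝ) else 0) ≤ Np m' T.card := by
    intro m' T _
    rcases m' with _ | m'
    · intro ι _ t
      exact Fin.elim0 (Fin.cast (Nat.mul_zero 2) t)
    · rw [show 2 * (m' + 1) = 2 * m' + 1 + 1 by ring]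
      intro ι hι t ht a
      -- rewrite the inherited indicator as a sum over parent choices
      have hind : ∀ Y : Fin (2 * m' + 1 + 1) → SpaceTimeIdx L M × SectorLeg N,
          (∏ j : T, (if A j (Y (ι j)) = true then (1 : ℝ) else 0)) =
            ∑ s ∈ Fintype.piFinset (fun j : T => Par (τ'' j)), ∏ j : T, (if (Y (ι j)).2 = s j then (1 : ℝ) else 0) := by
        intro Y
        rw [← prod_ite_mem_eq_sum_prod_ite_eq (fun j : T => Par (τ'' j)) (fun j : T => (Y (ι j)).2)]
        refine prod_congr rfl fun j _ => ?_
        simp only [hA, decide_eq_true_eq]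
      simp_rw [hind, mul_sum]
      rw [sum_comm]
      -- each parent choice is a single-label prescription: the bridge
      have hone : ∀ s ∈ Fintype.piFinset (fun j : T => Par (τ'' j)),
          ∑ Y ∈ univ.filter (fun Y : Fin (2 * m' + 1 + 1) → SpaceTimeIdx L M × SectorLeg N => Y t = a),
            ‖kernel ℂ (sectorPreimage β F G) (2 * m' + 1 + 1) Y‖ * ∏ j : T, (if (Y (ι j)).2 = s j then (1 : ℝ) else 0) ≤
            imagTimeWeight β M * B (m' + 1) T.card := fun s _ =>
        sum_norm_kernel_sectorPreimage_prescribedSlots_le_of_prescribedSum_le hβ.le F G (2 * m' + 1) (Fc := T.card)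
          (B := B (m' + 1) T.card) (fun E τ q hq hE y => hB m' T.card E τ q hq hE y) T rfl ι hι t ht s a
      refine (sum_le_sum hone).trans ?_
      rw [sum_const, nsmul_eq_mul, Fintype.card_piFinset]
      have hcard : ((∏ j : T, (Par (τ'' j)).card : ℕ) : ℝ) ≤ ρc ^ T.card := by
        rw [Nat.cast_prod, ← Fintype.card_coe T, ← Finset.card_univ, ← prod_const]
        exact prod_le_prod (fun j _ => Nat.cast_nonneg _) fun j _ => hρc (τ'' j)
      exact mul_le_mul_of_nonneg_right hcard (mul_nonneg hε (hB0 _ _))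
  -- the inherited predicates: a fine label only overlaps its parents
  have hPA : ∀ j ∈ J, ∀ (y'' : SpaceTimeIdx L M × SectorLeg N') (x' : SpaceTimeIdx L M × SectorLeg N),
      (fun (j : Fin (m + 1)) (X'' : SpaceTimeIdx L M × SectorLeg N') => X''.2 = τ'' j) j y'' →
        (LinearMap.toMatrix' (Matrix.toLin' (sectorAnalysisMatrix L M β F')) *
            LinearMap.toMatrix' (Matrix.toLin' (sectorSubMatrix L M β Ft))) y'' x' ≠ 0 → A j x' = true := by
    intro j _ y'' x' hPj hne
    rw [LinearMap.toMatrix'_toLin', LinearMap.toMatrix'_toLin'] at hne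
    obtain ⟨h1, h2, h3⟩ := hvan y'' x' hne
    have hPj' : y''.2 = τ'' j := hPj
    simp only [hA, hPar, decide_eq_true_eq, mem_filter, mem_univ, true_and, ← hPj']
    exact ⟨h1, h2, h3⟩
  -- transfer from `map S Ṽ` to `G` (plateau identities)
  have hea := map_sectorAnalysis_effAction_map_sectorPreimage_of_plateau hβ.ne' F Ft hFF hF0 F' G C hCpl hF'pl
  have hgc := map_sectorAnalysis_gaussConv_map_sectorPreimage_of_plateau hβ.ne' F Ft hFF hF0 F' G C hCpl hF'pl
  have hrepl : ExteriorAlgebra.map (Matrix.toLin' (sectorAnalysisMatrix L M β F')) (effAction ℂ C G - gaussConv ℂ C G) =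
      ExteriorAlgebra.map (Matrix.toLin' (sectorAnalysisMatrix L M β F'))
        (effAction ℂ C (ExteriorAlgebra.map (Matrix.toLin' (sectorSubMatrix L M β Ft)) (sectorPreimage β F G)) -
          gaussConv ℂ C (ExteriorAlgebra.map (Matrix.toLin' (sectorSubMatrix L M β Ft)) (sectorPreimage β F G))) := by
    rw [map_sub, map_sub, hea, hgc]
  rw [hrepl]
  exact sum_filter_norm_kernel_map_effAction_sub_gaussConv_le_graded_prescribed_of_gramBounded C
    (Matrix.toLin' (sectorSubMatrix L M β Ft)) (Matrix.toLin' (sectorAnalysisMatrix L M β F')) (sectorPreimage β F G)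
    (sectorPreimage_mem_evenPart β F hG) (by rw [constPart_sectorPreimage, hG0]) hκ (by simpa only [LinearMap.toMatrix'_toLin'] using hGB)
    p J hp (fun j X'' => X''.2 = τ'' j) A hPA Np hNp0 hN hα (by simpa only [LinearMap.toMatrix'_toLin'] using hrow)
    (by simpa only [LinearMap.toMatrix'_toLin'] using hcol) hρ hθ hcc0 (by simpa only [LinearMap.toMatrix'_toLin'] using hrow')
    (by simpa only [LinearMap.toMatrix'_toLin'] using hcol') hN₀ w''

end Transfer

end Literature.MathematicalPhysics.QuantumLattice

end
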